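import Summits.BirchSwinnertonDyer.BirchSwinnertonDyer.Theorems.PrintCf2SplitBadTwoTorsionStrictCountFrame
import Summits.BirchSwinnertonDyer.Rank1Residual.X11b.KummerStructureDuality
import Summits.BirchSwinnertonDyer.Rank1Residual.X11b.BDPRouteLevelToKummer
import HarnessLib

/-!
# Crux `PrintCf2.SplitBadTwoRankOneOfFacts` (stmt-BirchSwinnertonDyer-20368), road α v10.3, S3c input (F3), piece (U):
# Kummer classes are DUAL classes of the torsion-strict structure — the «free» inequality of (F3)

Cell `bsd-print-cf2`, EXTRA WIDTH seat `bsd-line-cf2-p1-w4` g9 (prover-bsd-line-cf2-p1-w4-g9-0); `--supports stmt-BirchSwinnertonDyer-20368`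
(helper, Theses-free). HONEST FRAMING: nothing here closes the crux or a registered stub; BSD is not proved by any of this; no summit
statement is proved by this seat. No definition, no named fact, no `sorry`. Continues p675947 (`TorsionStrictCountFrame`, Option A‴ of the
(F3) plan `Cruxes/SplitBadTwoRankOneOfFacts/F3-PLAN-w5g3.md`; -w2 g11 MATH NOTE (3)): the UPPER BOUND direction of (F3) is free — every global
class that is locally Kummer away from `v` and pairs to zero with `𝓕_v` at `v` is, after the Weil transport `H¹(w) : H¹(K, E[n]) → H¹(K, E[n]^D)`,
a class of the DUAL Selmer group `H¹_{𝓕*}(K, E[n]^D)` of the torsion-strict structure `𝓕` (X11b isotropy of the local Kummer conditions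
`invWeilPairing_eq_zero_of_mem`, Poonen–Rains Prop. 4.10 / Milne I Lemma 6.15, and `N^E_w ⊆ 𝓚_w`, X11b `ker_map_primaryInclusion_le_kummerLocalConditionAt`).

WHAT (generic `W/K` elliptic, `K` with all infinite places complex, prime `p`, level `n = p^N`, Weil pairing data `e` as in X11b, any additive
family `inv`, finite place `v`, torsion-strict `𝓕` with ARBITRARY `𝓕_v`):
* `map_weilDual_mem_dualSelmerGroup_of_torsionStrict` (U-mem): `y ∈ H¹(K, E[p^N])` Kummer at every finite `w ≠ v` and `⟨𝓕_v, loc_v y⟩_v = 0`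
  ⟹ `H¹(w) y ∈ H¹_{𝓕*}(K, E[p^N]^D)`.
* `natCard_map_localization_le_of_torsionStrict` (U-count): for a subgroup `S` of such classes, **`#loc_v(S) ≤ #loc_v(H¹_{𝓕*}(K, E[p^N]^D))`**
  (`H¹(w|_{K_v})` is injective, X11b `map_weilDual_restrictField_injective`).
* `relIndex_selmerGroup_update_top_mul_le_sq` (U-bound): with p675947, **`[H¹_{𝓕[⊤ at v]} : H¹_𝓕] · #loc_v(S) · #𝓕_v ≤ (#E(K_v)[p^N] · #(𝓞_v ⧸ p^N))²`.**
USE for (F3) (CM member, `L_v = (N^E_v).comap H¹(e_N)`): `S :=` the `W*′`-projected Kummer classes `e′_* κ_N(E(K))` (they pair to zero with `L_v`: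
`e′`-component Kummer, `e`-component zero), `#loc_v(S) = 2^{N − dep(P) + 1}` (-w2 g11 (P3′), -w6 g3 p675150) ⟹ `#range(loc_v | 𝔖_{v̄}(K, W*)) ≤ 2^{dep(P)} · [W*′(K_v) : W*′(K)]`
— the `≤` half of (F3); the `≥` half is the rank-one index bound (`SelmerComplement` side, LEAD memo §3 / -w2 g11 (3)(a)/(b)).
presearch: Poonen–Rains 2012 Prop. 4.10 / Milne ADT I Lemma 6.15 (Kummer maximal isotropic) → tree theorems (X11b `KummerStructureDuality`,
`BDPRouteRelaxation`); no new fact. beyond-print theorem: no.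

References: [PoonenRains2012] Prop. 4.8, 4.10; [MilneADT2006] I Cor. 3.4, Lemma 6.15, Thm. 4.10; [Howard2004HeegnerKolyvagin] Def. 2.1.6, Thm. 2.1.11;
[JetchevSkinnerWan2017] Prop. 3.2.1.
-/

noncomputable section

open scoped Classical

set_option linter.dupNamespace false
set_option autoImplicit false

open Function Field NumberField IsDedekindDomain WeierstrassCurve
open Literature.NumberTheory.EllipticCurves
open Literature.NumberTheory.GaloisRepresentations
open Literature.NumberTheory.GaloisRepresentations.DiscreteGaloisModule (localTatePairingZMod tateDual SelmerStructure mu)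
open Literature.NumberTheory.GaloisCohomology
open Literature.NumberTheory.GaloisCohomology.LocalInvariants
open scoped ContRepresentation
open Summit.BirchSwinnertonDyer.Rank1Residual.X11b
open Summit.BirchSwinnertonDyer.Rank1Residual.X11b.LocBridge
open Summit.BirchSwinnertonDyer.Rank1Residual.X11b.Relaxation

namespace Summit.BirchSwinnertonDyer.BirchSwinnertonDyer.Theorems.PrintCf2.RestrictedSelmerPair

-- The binders `[NeZero (p ^ N)] [Finite E[p^N]]` are the tree's `finite_geomTorsion_of_neZero` etc., supplied by consumers with `haveI`.

section Dual

variable {K : Type} [Field K] [NumberField K] (W : WeierstrassCurve K) [W.IsElliptic] (p : ℕ) [hp : Fact p.Prime] (N : ℕ)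
  [NeZero (p ^ N)] [Finite (W.geomTorsion ((p ^ N : ℕ) : ℤ))]
variable (e : geomTorsion W (p ^ N) → geomTorsion W (p ^ N) → AlgebraicClosure K)
  (hμ : ∀ S T, e S T ^ (p ^ N) = 1)
  (hadd₁ : ∀ S₁ S₂ T, e (S₁ + S₂) T = e S₁ T * e S₂ T)
  (hadd₂ : ∀ S T₁ T₂, e S (T₁ + T₂) = e S T₁ * e S T₂)
  (hgal : ∀ (σ : absoluteGaloisGroup K) (S T : geomTorsion W (p ^ N)), σ • e S T = e (σ • S) (σ • T))
  (halt : ∀ T, e T T = 1) (hnondeg : ∀ T, (∀ S, e S T = 1) → T = 0)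
  (inv : LocalInvariants K (p ^ N))

omit hp in
include halt in
/-- **(U-mem) Kummer classes are dual classes of the torsion-strict structure.** Let `𝓕` be torsion-strict away from `v`
(`𝓕_w = ker(H¹(K_w, E[p^N]) → H¹(K_w, E[p^∞]))`, `w ≠ v` finite; anything at `v` and at infinity), `K` totally complex. If `y ∈ H¹(K, E[p^N])` is
locally Kummer at every finite `w ≠ v` and `inv_v(a ∪ₑ loc_v y) = 0` for all `a ∈ 𝓕_v`, then `H¹(w) y ∈ H¹_{𝓕*}(K, E[p^N]^D)`: at `w ≠ v`,
`𝓕_w ⊆ 𝓛_w` (X11b `ker_map_primaryInclusion_le_kummerLocalConditionAt`) and `𝓛_w` is isotropic for `inv_w(· ∪ₑ ·)` (X11b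
`invWeilPairing_eq_zero_of_mem`); `⟨a, H¹(w) b⟩_w = inv_w(a ∪ₑ b)` (X11b `localTatePairingZMod_map_weilDual`); complex places carry `H¹ = 0`.
[cite: PoonenRains2012, Prop. 4.10] [cite: MilneADT2006, I Lemma 6.15] [cite: Howard2004HeegnerKolyvagin, Def. 2.1.6 (arXiv:1202.6340 p. 5)] -/
theorem map_weilDual_mem_dualSelmerGroup_of_torsionStrict (hK : ∀ w : InfinitePlace K, w.IsComplex) (v : HeightOneSpectrum (𝓞 K))
    (𝓕 : SelmerStructure (W.torsionGaloisModule ((p ^ N : ℕ) : ℤ)))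
    (h𝓕 : ∀ w : HeightOneSpectrum (𝓞 K), w ≠ v →
      𝓕 (Sum.inr w) = (galoisCohomology.map ((Levels.primaryInclusion W p N).restrictField (w.adicCompletion K)) 1).ker)
    {y : galoisCohomology (W.torsionGaloisModule ((p ^ N : ℕ) : ℤ)) 1}
    (hy : ∀ w : HeightOneSpectrum (𝓞 K), w ≠ v →
      galoisCohomology.localization (W.torsionGaloisModule ((p ^ N : ℕ) : ℤ)) (Sum.inr w) 1 y ∈
        W.kummerSelmerStructure (p ^ N) (Sum.inr w))
    (hyv : ∀ a ∈ 𝓕 (Sum.inr v), invWeilPairing W (p ^ N) e hμ hadd₁ hadd₂ hgal inv (Sum.inr v) a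
      (galoisCohomology.localization (W.torsionGaloisModule ((p ^ N : ℕ) : ℤ)) (Sum.inr v) 1 y) = 0) :
    galoisCohomology.map (weilDualIntertwining W (p ^ N) e hμ hadd₁ hadd₂ hgal) 1 y ∈
      (inv.dualSelmerStructure (W.torsionGaloisModule ((p ^ N : ℕ) : ℤ)) 𝓕).selmerGroup := by
  refine (SelmerStructure.mem_selmerGroup_iff _ _).mpr fun w ↦ ?_
  rw [Levels.localization_map_one, LocalInvariants.dualSelmerStructure_apply, LocalInvariants.mem_dualLocalCondition_iff]
  intro a ha
  rw [localTatePairingZMod_map_weilDual, ← invWeilPairing_apply W (p ^ N) e hμ hadd₁ hadd₂ hgal inv]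
  rcases w with w | w
  · haveI := subsingleton_galoisCohomology_toLocal_inl_of_isComplex (W.torsionGaloisModule ((p ^ N : ℕ) : ℤ)) (hK w)
    rw [Subsingleton.elim a 0, map_zero, AddMonoidHom.zero_apply]
  · by_cases hw : w = v
    · subst hw
      exact hyv a ha
    · have ha' : a ∈ W.kummerSelmerStructure (p ^ N) (Sum.inr w) := by
        rw [h𝓕 w hw] at ha
        rw [kummerSelmerStructure_apply]
        change a ∈ W.kummerLocalConditionAt ((p ^ N : ℕ) : ℤ) (w.adicCompletion K)
        exact LevelKummer.ker_map_primaryInclusion_le_kummerLocalConditionAt W p N (w.adicCompletion K) ha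
      exact invWeilPairing_eq_zero_of_mem W (p ^ N) e hμ hadd₁ hadd₂ hgal halt inv (Sum.inr w) ha' (hy w hw)

omit hp in
include halt hnondeg in
/-- **(U-count) `#loc_v(S) ≤ #loc_v(H¹_{𝓕*}(K, E[p^N]^D))`** for every subgroup `S ≤ H¹(K, E[p^N])` of classes that are locally Kummer away from `v`
and pair to zero with `𝓕_v` at `v` (`𝓕` torsion-strict away from `v`, `K` totally complex): `loc_v y ↦ H¹(w|_{K_v})(loc_v y) = loc_v(H¹(w) y)`
is injective (X11b `map_weilDual_restrictField_injective`) with values in `loc_v(H¹_{𝓕*})` by (U-mem).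
[cite: MilneADT2006, I Lemma 6.15 and Thm. 4.10] [cite: Howard2004HeegnerKolyvagin, Thm. 2.1.11 (arXiv:1202.6340 p. 6)] -/
theorem natCard_map_localization_le_of_torsionStrict (hK : ∀ w : InfinitePlace K, w.IsComplex) (v : HeightOneSpectrum (𝓞 K))
    (𝓕 : SelmerStructure (W.torsionGaloisModule ((p ^ N : ℕ) : ℤ)))
    (h𝓕 : ∀ w : HeightOneSpectrum (𝓞 K), w ≠ v →
      𝓕 (Sum.inr w) = (galoisCohomology.map ((Levels.primaryInclusion W p N).restrictField (w.adicCompletion K)) 1).ker)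
    (S : AddSubgroup (galoisCohomology (W.torsionGaloisModule ((p ^ N : ℕ) : ℤ)) 1))
    (hS : ∀ y ∈ S, ∀ w : HeightOneSpectrum (𝓞 K), w ≠ v →
      galoisCohomology.localization (W.torsionGaloisModule ((p ^ N : ℕ) : ℤ)) (Sum.inr w) 1 y ∈
        W.kummerSelmerStructure (p ^ N) (Sum.inr w))
    (hSv : ∀ y ∈ S, ∀ a ∈ 𝓕 (Sum.inr v), invWeilPairing W (p ^ N) e hμ hadd₁ hadd₂ hgal inv (Sum.inr v) a
      (galoisCohomology.localization (W.torsionGaloisModule ((p ^ N : ℕ) : ℤ)) (Sum.inr v) 1 y) = 0) :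
    Nat.card (S.map (galoisCohomology.localization (W.torsionGaloisModule ((p ^ N : ℕ) : ℤ)) (Sum.inr v) 1)) ≤
      Nat.card (((inv.dualSelmerStructure (W.torsionGaloisModule ((p ^ N : ℕ) : ℤ)) 𝓕).selmerGroup).map
        (galoisCohomology.localization ((W.torsionGaloisModule ((p ^ N : ℕ) : ℤ)).tateDual (p ^ N)) (Sum.inr v : Place K) 1)) := by
  haveI : Finite (galoisCohomology (((W.torsionGaloisModule ((p ^ N : ℕ) : ℤ)).tateDual (p ^ N)).toLocal (Sum.inr v)) 1) :=
    finite_galoisCohomology_one_tateDual_toLocal _ (p ^ N) v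
  refine Nat.card_le_card_of_injective
    (fun z ↦ ⟨galoisCohomology.map ((weilDualIntertwining W (p ^ N) e hμ hadd₁ hadd₂ hgal).restrictField
      (Place.Completion (Sum.inr v : Place K))) 1 z.1, ?_⟩) fun z z' h ↦ ?_
  · obtain ⟨y, hyS, hy⟩ := z.2
    refine ⟨galoisCohomology.map (weilDualIntertwining W (p ^ N) e hμ hadd₁ hadd₂ hgal) 1 y,
      map_weilDual_mem_dualSelmerGroup_of_torsionStrict W p N e hμ hadd₁ hadd₂ hgal halt inv hK v 𝓕 h𝓕
        (fun w hw ↦ hS y hyS w hw) (hSv y hyS), ?_⟩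
    rw [Levels.localization_map_one, hy]
  · exact Subtype.ext (map_weilDual_restrictField_injective W (p ^ N) e hμ hadd₁ hadd₂ hgal hnondeg
      (Place.Completion (Sum.inr v : Place K)) (congrArg Subtype.val h))

include halt hnondeg in
/-- **(U-bound) the free inequality of (F3): `[H¹_{𝓕[⊤ at v]}(K, E[p^N]) : H¹_𝓕(K, E[p^N])] · #loc_v(S) · #𝓕_v ≤ (#E(K_v)[p^N] · #(𝓞_v ⧸ p^N))²`**
for the torsion-strict `𝓕` (anything at `v`), `S` as in (U-count), `inv` the level-`p^N` Poitou–Tate family (`IsPerfect`, `SumLocalTermEqZero`,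
`SelmerComplement`), `T ⊇ ∞ ∪ {w ∣ p} ∪ {bad} ∋ v`, `N ≥ 1`, `K` totally complex: p675947 `relIndex_selmerGroup_update_top_mul_eq_sq` and (U-count).
[cite: MilneADT2006, I Thm. 4.10, Thm. 2.8, Lemma 6.15] [cite: Howard2004HeegnerKolyvagin, Thm. 2.1.11 (arXiv:1202.6340 p. 6)] -/
theorem relIndex_selmerGroup_update_top_mul_le_sq (hK : ∀ w : InfinitePlace K, w.IsComplex) (hN : 0 < N) (hperf : inv.IsPerfect)
    (hvan : inv.SumLocalTermEqZero) (hcomp : inv.SelmerComplement) (T : Finset (Place K))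
    (hinf : ∀ w : InfinitePlace K, (Sum.inl w : Place K) ∈ T)
    (hpT : ∀ w : HeightOneSpectrum (𝓞 K), ((p : ℕ) : 𝓞 K) ∈ w.asIdeal → (Sum.inr w : Place K) ∈ T)
    (hbad : ∀ w : HeightOneSpectrum (𝓞 K), ¬ W.HasGoodReductionAt w → (Sum.inr w : Place K) ∈ T)
    (v : HeightOneSpectrum (𝓞 K)) (hv : (Sum.inr v : Place K) ∈ T) (𝓕 : SelmerStructure (W.torsionGaloisModule ((p ^ N : ℕ) : ℤ)))
    (h𝓕 : ∀ w : HeightOneSpectrum (𝓞 K), w ≠ v →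
      𝓕 (Sum.inr w) = (galoisCohomology.map ((Levels.primaryInclusion W p N).restrictField (w.adicCompletion K)) 1).ker)
    (S : AddSubgroup (galoisCohomology (W.torsionGaloisModule ((p ^ N : ℕ) : ℤ)) 1))
    (hS : ∀ y ∈ S, ∀ w : HeightOneSpectrum (𝓞 K), w ≠ v →
      galoisCohomology.localization (W.torsionGaloisModule ((p ^ N : ℕ) : ℤ)) (Sum.inr w) 1 y ∈
        W.kummerSelmerStructure (p ^ N) (Sum.inr w))
    (hSv : ∀ y ∈ S, ∀ a ∈ 𝓕 (Sum.inr v), invWeilPairing W (p ^ N) e hμ hadd₁ hadd₂ hgal inv (Sum.inr v) a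
      (galoisCohomology.localization (W.torsionGaloisModule ((p ^ N : ℕ) : ℤ)) (Sum.inr v) 1 y) = 0) :
    𝓕.selmerGroup.relIndex (SelmerStructure.selmerGroup (Function.update 𝓕 (Sum.inr v : Place K) ⊤)) *
        Nat.card (S.map (galoisCohomology.localization (W.torsionGaloisModule ((p ^ N : ℕ) : ℤ)) (Sum.inr v) 1)) *
        Nat.card (𝓕 (Sum.inr v)) ≤
      (Nat.card (nsmulAddMonoidHom (p ^ N) : (W.baseChange (v.adicCompletion K)).toAffine.Point →+ _).ker *
        Nat.card (v.adicCompletionIntegers K ⧸ Ideal.span {((p ^ N : ℕ) : v.adicCompletionIntegers K)})) ^ 2 := by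
  rw [← relIndex_selmerGroup_update_top_mul_eq_sq W p N hN hperf hvan hcomp T hinf hpT hbad v hv 𝓕 h𝓕]
  exact Nat.mul_le_mul_right _ (Nat.mul_le_mul_left _
    (natCard_map_localization_le_of_torsionStrict W p N e hμ hadd₁ hadd₂ hgal halt hnondeg inv hK v 𝓕 h𝓕 S hS hSv))

end Dual

end Summit.BirchSwinnertonDyer.BirchSwinnertonDyer.Theorems.PrintCf2.RestrictedSelmerPair

end
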